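import Summits.QuantumFields.YangMills.Theorems.UnitScaleTiltProp7AxialGaugeFace
import Summits.QuantumFields.YangMills.Theorems.UnitScaleTiltProp7AxialGauge
import Literature.MathematicalPhysics.QuantumFieldTheory.Balaban1983to89.BlockAveragingEMLProp2
import HarnessLib

/-!
# THE ITERATED RESIDUAL AXIAL GAUGE, ONE LEVEL: block geometry at an arbitrary height and the two sup letters of one averaging step
# (crux `FluctuationComparisonRegPrIntL`, stmt-QuantumFields-20520; registry v11.4 `Cruxes/FluctuationComparisonRegPrIntL/Lines/semiclassical_s2beta.lean` 3732b7df FROZEN, untouched)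

Cell `ym3-torus` (YM ladder rung R3 = continuum `SU(2)` Yang–Mills on the three-torus — a RUNG: NOT d = 4, NOT infinite volume, NOT a mass gap, NOT Clay).
Width seat `ym3-torus-px10` (gen 21); `--kind proof --supports stmt-QuantumFields-20520 --as helper`, count-neutral, DEFINITION-FREE (0 `def`, 0 `instance`,
0 `notation`, 0 `sorry`, default heartbeats).

WHY.  px8 g21's UV3-NODE §57.7 LEMMA («iterated residual axial gauge»; px12 g22 note v4 §7: it retires the located obstacle (α) of the `hFlat` road):
gauge-fix a good history TOP-DOWN — `h ≡ 1` on the `m`-lattice, `h(x) := h(y)·U^{(j)}(Γ_{emb y, x})` for `x` in the `(j+1)`-block of `y` — so that EVERY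
level's averaged field becomes bondwise `O(L²·Σ_{i ≥ j} θ_i)`-small.  This file is the ONE-LEVEL input of that induction, at an ARBITRARY height `j` of an
arbitrary torus of the `Setup` tower (`Site P j`, standing range `j + 1 ≤ m + K`), for ANY gauge group and ANY small-loop average `ℰ`:
* §1 BLOCK GEOMETRY at height `j` (the tree had it at height `0` for `k`-fold blocks — ✓`Prop7AxialGaugeBlock`∕`…Face` — and in [DAGN18]'s currency):
  every site is `emb(block) +` a centred offset (`transl_emb_off`, `rel_emb_blockSite`, `exists_blockSite`), `|x − emb y|_ν ≤ (L−1)∕2`,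
  `|x − emb y|₁ ≤ d(L−1)∕2`, no wrap-around of the comb bond (lit ✓`Site.blockOf_emb`); on a FACE (`x_μ ≡ L − 1 (mod L)`, lit ✓`B10StarCount.blockOf_shift`)
  the relative position seen from the next centre is `rel + e_μ − L·e_μ`, so the face word `Γ_{emb y,x} ∪ [x, x+e_μ] ∪ (−Γ_{emb y′, x+e_μ})` closed by
  `(−c)` has zero net displacement and length `≤ d(L−1) + L + 1`.
* §2 THE COMB STEP of the gauge: `g x = g′(blockOf x)·U(Γ_{emb(blockOf x), x})` ⟹ `g ∘ emb = g′` (`comb_emb`), the gauged field `g • U` is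
  comb-axial (`axialT (g • U) (emb (blockOf x)) x = 1`), and
  ★ INTERIOR LETTER `dist1_gaugeAct_interior_le`: a bond inside one block is within `|x − emb y|₁·δ ≤ (d(L−1)∕2)·δ` of `1` under `PlaqSmall δ U`
  (comb-fan Stokes ✓`Prop7AxialGaugeSup.dist1_holAt_combLoop_le` through ✓`B10Eq27TorusAxialLog.holT_contourT_eq_gaugeActT`);
  ★★ FACE LETTER `dist1_gaugeAct_face_le`: a bond leaving the block of `y` through the `μ`-face is within
  `dist1((g′ • Ū)⟨y, μ⟩) + dist1(corr ℰ U ⟨y, μ⟩) + ((d(L−1) + L + 1)²∕4)·δ` of `1`, `Ū = avgFun ℰ U` the (0.4) average — the coarse bond in the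
  NEXT level's gauge (the induction hypothesis), the correction factor (lit ✓`BlockAveragingEMLProp2.dist1_corr_le_two_mul` for `ℰp`), and the crude
  non-abelian Stokes bound of the closed face word (lit ✓`LatticeWordStokes.dist1_holAt_le`); the identity behind it is
  `(g • U)⟨x, μ⟩ = g′ y · U(Γ₂) · g′(y + e_μ)⁻¹` (✓`Prop7AxialGaugeFace.holAt_faceWord_of_axial`).
The induction over the tower, the existence of the gauge family and the `T³` reading are the companion file `…IterAxialGaugeSup`.

HONEST: lattice bookkeeping BY NAME over landed letters; nothing of Bałaban's analysis ([Balaban1985RegularSpaces] Lemma 1 (1.24)–(1.26) is the printed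
one-level statement in the regular-space scaling); `hFlat`, TUBE-REG∘, GAP♯∘, S2β, crux 20520 NOT proved; no registered stub is closed; rung R3 = SU(2) YM₃ on T³ —
NOT d = 4, NOT infinite volume, NOT a mass gap, NOT Clay; the Yang–Mills mass gap is NOT proved.  Sorry-free, axioms standard.

References: T. Bałaban, CMP **99** (1985) 75–102 [Balaban1985RegularSpaces] (Lemma 1 (1.24)–(1.26) pp.79–80, (1.29) p.81); CMP **98** (1985) 17–51
[Balaban1985Averaging] ((8)–(9) pp.18–19, (19)–(20) p.21, pp.24–25); CMP **109** (1987) 249–301 [Balaban1987RG1] ((0.1)–(0.4) pp.251–253).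
-/

set_option autoImplicit false

namespace Summit.QuantumFields.YangMills.Theorems.FluctuationComparisonRegPrIntLS2BetaIterAxialGaugeOneLevel

open Literature.MathematicalPhysics.QuantumFieldTheory.Balaban1983to89
open T4Continuum T4ReflectionCone BlockAveraging LatticeWordStokes
open B10Eq27TorusAxialLog (transl rel holT axialT gaugeActT contourT transl_apply transl_add transl_add_e transl_rel rel_apply
  rel_transl_of_mem holT_eq_holAt contourT_eq holT_contourT_eq_gaugeActT gaugeActT_eq_gaugeAct gaugeActT_apply axialT_self)
open B7Prop1Explicit (treeWord e e_apply l1 revWord length_treeWord)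
open Summit.QuantumFields.YangMills.Theorems.Prop7AxialGauge (axialT_gaugeActT)
open Summit.QuantumFields.YangMills.Theorems.Prop7AxialGaugeSup (revWord_eq_wordRev dist1_holAt_combLoop_le)
open Summit.QuantumFields.YangMills.Theorems.Prop7AxialGaugeFace (holAt_faceWord_of_axial netDisp_faceWord netDisp_treeWord walkEnd_treeWord_rel)
open BlockAveragingEMLProp2 (holAt_walk_replicate_false_tgt)

variable {P : Params} {j : ℕ}

/-! ## §1 Block geometry at height `j` -/

section Geometry

/-- The site count per direction at height `j` is `L` times that at height `j + 1`, which is at least `2`: `2L ≤ |T^{(j)}|_ν` (standing range). [folklore] -/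
private theorem two_mul_L_le_sitesPerDir (hj : j + 1 ≤ P.m + P.K) : 2 * P.L ≤ P.sitesPerDir j := by
  rw [P.sitesPerDir_eq_mul_succ hj]
  have h2 : 2 ≤ P.sitesPerDir (j + 1) := by
    unfold Params.sitesPerDir
    have := Nat.one_le_pow (P.m + P.K - (j + 1)) P.L P.L_pos
    omega
  nlinarith

/-- A block site is its centre translated by the centred offset: `emb y + off r = blockSite y r`. [cite: Balaban1987RG1, (0.3) p.252] -/
private theorem transl_emb_off (y : Site P (j + 1)) (r : Fin P.d → Fin P.L) : transl (emb y) (off r) = Site.blockSite y r := by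
  funext ν
  rw [transl_apply]
  simp only [emb, off, Site.blockSite]
  set h : ℕ := (P.L - 1) / 2 with hh
  push_cast
  ring

/-- **The relative position of a block site from its block centre IS the centred offset** (`|·|_ν ≤ (L−1)∕2 <` half the period; standing range).
[cite: Balaban1987RG1, (0.3) p.252] -/
private theorem rel_emb_blockSite (hj : j + 1 ≤ P.m + P.K) (y : Site P (j + 1)) (r : Fin P.d → Fin P.L) :
    rel (emb y) (Site.blockSite y r) = off r := by
  rw [← transl_emb_off]
  refine rel_transl_of_mem _ _ fun ν => ?_
  have hL := AveragingRT.two_mul_half_add_one P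
  have hN := two_mul_L_le_sitesPerDir hj
  have hb := off_bounds r ν
  have hN' : (2 : ℤ) * P.L ≤ (P.sitesPerDir j : ℤ) := by exact_mod_cast hN
  constructor <;> omega

/-- Every site of height `j` is a block site of its own block. [cite: Balaban1987RG1, (0.3) p.252] -/
theorem exists_blockSite (hj : j + 1 ≤ P.m + P.K) (x : Site P j) : ∃ r : Fin P.d → Fin P.L, x = Site.blockSite (blockOf x) r :=
  ⟨Site.blockEquiv hj (blockOf x) ⟨x, rfl⟩,
    (congrArg Subtype.val ((Site.blockEquiv hj (blockOf x)).symm_apply_apply ⟨x, rfl⟩)).symm⟩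

/-- The offset `r` of `x` in its block is the residue of its label: `r_μ = x_μ mod L`. [cite: Balaban1987RG1, (0.3) p.252] -/
theorem val_mod_of_eq_blockSite (hj : j + 1 ≤ P.m + P.K) {x : Site P j} {y : Site P (j + 1)} {r : Fin P.d → Fin P.L}
    (hx : x = Site.blockSite y r) (μ : Fin P.d) : (x μ).val % P.L = (r μ : ℕ) := by
  rw [hx, Site.val_blockSite hj, Nat.mul_add_mod', Nat.mod_eq_of_lt (r μ).isLt]

/-- **A block site is within `(L−1)∕2` of its centre in every coordinate.** [cite: Balaban1987RG1, (0.3) p.252] -/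
theorem natAbs_rel_emb_le (hj : j + 1 ≤ P.m + P.K) {x : Site P j} {y : Site P (j + 1)} (hx : blockOf x = y) (ν : Fin P.d) :
    (rel (emb y) x ν).natAbs ≤ (P.L - 1) / 2 := by
  obtain ⟨r, hr⟩ := exists_blockSite hj x
  rw [hx] at hr
  rw [hr, rel_emb_blockSite hj]
  have := off_bounds r ν
  omega

/-- **A block site is within `ℓ¹`-distance `d(L−1)∕2` of its centre.** [cite: Balaban1987RG1, (0.3) p.252] -/
theorem l1_rel_emb_le (hj : j + 1 ≤ P.m + P.K) {x : Site P j} {y : Site P (j + 1)} (hx : blockOf x = y) :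
    l1 (rel (emb y) x) ≤ P.d * ((P.L - 1) / 2) := by
  unfold l1
  calc ∑ κ, (rel (emb y) x κ).natAbs ≤ ∑ _κ : Fin P.d, (P.L - 1) / 2 := Finset.sum_le_sum fun κ _ => natAbs_rel_emb_le hj hx κ
    _ = P.d * ((P.L - 1) / 2) := by rw [Finset.sum_const, Finset.card_univ, Fintype.card_fin, smul_eq_mul]

/-- **No wrap-around of a comb bond**: for `x` in the block of `y`, `2((x − emb y)_μ + 1) ≤ |T^{(j)}|_μ`. [cite: Balaban1987RG1, (0.1) p.251] -/
theorem noWrap_emb (hj : j + 1 ≤ P.m + P.K) {x : Site P j} {y : Site P (j + 1)} (hx : blockOf x = y) (μ : Fin P.d) :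
    (rel (emb y) x μ + 1) * 2 ≤ (P.sitesPerDir j : ℤ) := by
  have h := natAbs_rel_emb_le hj hx μ
  have hL := AveragingRT.two_mul_half_add_one P
  have hN : (2 : ℤ) * P.L ≤ (P.sitesPerDir j : ℤ) := by exact_mod_cast two_mul_L_le_sitesPerDir hj
  have h1 : rel (emb y) x μ ≤ (((P.L - 1) / 2 : ℕ) : ℤ) := le_trans Int.le_natAbs (by exact_mod_cast h)
  omega

/-- **On a face the `μ`-coordinate of the relative position is maximal**: `x_μ ≡ L − 1 (mod L)` ⟹ `(x − emb y)_μ = (L−1)∕2`.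
[cite: Balaban1987RG1, (0.3) p.252] -/
theorem rel_emb_face (hj : j + 1 ≤ P.m + P.K) {x : Site P j} {y : Site P (j + 1)} (hx : blockOf x = y) {μ : Fin P.d}
    (hface : (x μ).val % P.L + 1 = P.L) : rel (emb y) x μ = (((P.L - 1) / 2 : ℕ) : ℤ) := by
  obtain ⟨r, hr⟩ := exists_blockSite hj x
  rw [hx] at hr
  have hrμ := val_mod_of_eq_blockSite hj hr μ
  rw [hr, rel_emb_blockSite hj]
  have hL := AveragingRT.two_mul_half_add_one P
  simp only [off]
  omega

/-- The next centre is the translate by `L·e_μ`: `emb (y + e_μ) = emb y + L e_μ`. [cite: Balaban1987RG1, (0.1) p.252] -/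
theorem emb_shift_eq_transl (y : Site P (j + 1)) (μ : Fin P.d) : emb (y.shift μ) = transl (emb y) ((P.L : ℤ) • e μ) := by
  funext ν
  rw [emb_shift_apply, transl_apply, Pi.smul_apply, e_apply, smul_eq_mul]
  by_cases h : ν = μ
  · subst h; simp
  · simp [h]

/-- **The relative position of `x + e_μ` from the NEXT centre** when `x` lies on the `μ`-face of the block of `y`:
`(x + e_μ) − emb(y + e_μ) = (x − emb y) + e_μ − L·e_μ` (no wrap; standing range). [cite: Balaban1985RegularSpaces, (1.26) p.79] -/
theorem rel_emb_shift_of_face (hj : j + 1 ≤ P.m + P.K) {x : Site P j} {y : Site P (j + 1)} (hx : blockOf x = y) {μ : Fin P.d}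
    (hface : (x μ).val % P.L + 1 = P.L) :
    rel (emb (y.shift μ)) (x.shift μ) = rel (emb y) x + e μ - (P.L : ℤ) • e μ := by
  have hL := AveragingRT.two_mul_half_add_one P
  have hN : (2 : ℤ) * P.L ≤ (P.sitesPerDir j : ℤ) := by exact_mod_cast two_mul_L_le_sitesPerDir hj
  have hxs : x.shift μ = transl (emb (y.shift μ)) (rel (emb y) x + e μ - (P.L : ℤ) • e μ) := by
    rw [emb_shift_eq_transl, ← transl_add, show (P.L : ℤ) • e μ + (rel (emb y) x + e μ - (P.L : ℤ) • e μ) = rel (emb y) x + e μ by abel,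
      transl_add_e, transl_rel]
  rw [hxs]
  refine rel_transl_of_mem _ _ fun ν => ?_
  rw [Pi.sub_apply, Pi.add_apply, Pi.smul_apply, e_apply, smul_eq_mul]
  by_cases hν : ν = μ
  · subst hν
    rw [if_pos rfl, mul_one, rel_emb_face hj hx hface]
    constructor <;> omega
  · rw [if_neg hν, mul_zero, add_zero, sub_zero]
    have h := natAbs_rel_emb_le hj hx ν
    have h1 : rel (emb y) x ν ≤ (((P.L - 1) / 2 : ℕ) : ℤ) := le_trans Int.le_natAbs (by exact_mod_cast h)
    have h2 : -(((P.L - 1) / 2 : ℕ) : ℤ) ≤ rel (emb y) x ν := by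
      have h' : |rel (emb y) x ν| ≤ (((P.L - 1) / 2 : ℕ) : ℤ) := by rw [Int.abs_eq_natAbs]; exact_mod_cast h
      exact (abs_le.mp h').1
    constructor <;> omega

/-- **THE CLOSED FACE WORD HAS ZERO NET DISPLACEMENT**: `Γ_{emb y,x} ∪ [x, x+e_μ] ∪ (−Γ_{emb y′, x+e_μ}) ∪ (−c)` (`y′ = y + e_μ`, `c` the straight `L`-run
back) returns to `emb y`. [cite: Balaban1985RegularSpaces, (1.26) p.79] -/
theorem netDisp_faceLoop (hj : j + 1 ≤ P.m + P.K) {x : Site P j} {y : Site P (j + 1)} (hx : blockOf x = y) {μ : Fin P.d}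
    (hface : (x μ).val % P.L + 1 = P.L) (ν : Fin P.d) :
    netDisp (treeWord (rel (emb y) x) ++ [(μ, true)] ++ wordRev (treeWord (rel (emb (y.shift μ)) (x.shift μ))) ++
      List.replicate P.L (μ, false)) ν = 0 := by
  rw [netDisp_append, netDisp_faceWord, rel_emb_shift_of_face hj hx hface, netDisp_replicate]
  simp only [Pi.sub_apply, Pi.add_apply, Pi.smul_apply, e_apply, smul_eq_mul]
  by_cases hν : μ = ν
  · subst hν; simp
  · simp [hν, Ne.symm hν]

/-- Reversal preserves length. [folklore] -/
private theorem length_wordRev'' {d : ℕ} (w : List (Letter d)) : (wordRev w).length = w.length := by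
  simp [wordRev]

/-- The closed face word has length `≤ d(L−1) + L + 1`. [folklore] -/
theorem length_faceLoop_le (hj : j + 1 ≤ P.m + P.K) {x : Site P j} {y : Site P (j + 1)} (hx : blockOf x = y) {μ : Fin P.d}
    (hface : (x μ).val % P.L + 1 = P.L) :
    (treeWord (rel (emb y) x) ++ [(μ, true)] ++ wordRev (treeWord (rel (emb (y.shift μ)) (x.shift μ))) ++
      List.replicate P.L (μ, false)).length ≤ P.d * (P.L - 1) + P.L + 1 := by
  have hx' : blockOf (x.shift μ) = y.shift μ := by rw [B10StarCount.blockOf_shift hj, if_pos hface, hx]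
  have h1 := l1_rel_emb_le hj hx
  have h2 := l1_rel_emb_le hj hx'
  have hL := AveragingRT.two_mul_half_add_one P
  simp only [List.length_append, length_treeWord, length_wordRev'', List.length_singleton, List.length_replicate]
  have hd : P.d * ((P.L - 1) / 2) + P.d * ((P.L - 1) / 2) ≤ P.d * (P.L - 1) := by
    rw [← Nat.mul_add]; exact Nat.mul_le_mul_left _ (by omega)
  omega

end Geometry

/-! ## §2 The comb step of the gauge and its two sup letters -/

section CombStep

variable {G : Type*} [GaugeGroup G]

/-- **THE COMB STEP RESTRICTS TO THE COARSE GAUGE AT THE CENTRES**: `g(emb y) = g′(y)` (empty comb). [cite: Balaban1985RegularSpaces, (1.19) p.79] -/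
theorem comb_emb (hj : j + 1 ≤ P.m + P.K) (U : GaugeField P j G) (g : Site P j → G) (g' : Site P (j + 1) → G)
    (hrec : ∀ x, g x = g' (blockOf x) * axialT U (emb (blockOf x)) x) (y : Site P (j + 1)) : g (emb y) = g' y := by
  rw [hrec, Site.blockOf_emb hj, axialT_self, mul_one]

/-- **THE GAUGED FIELD IS COMB-AXIAL**: every comb holonomy of `g • U` from the centre of a block to its sites is `1`.
[cite: Balaban1985RegularSpaces, (1.19) p.79; Balaban1985Averaging, p.24] -/
theorem axialT_gaugeAct_comb (hj : j + 1 ≤ P.m + P.K) (U : GaugeField P j G) (g : Site P j → G) (g' : Site P (j + 1) → G)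
    (hrec : ∀ x, g x = g' (blockOf x) * axialT U (emb (blockOf x)) x) (x : Site P j) :
    axialT (GaugeField.gaugeAct g U) (emb (blockOf x)) x = 1 := by
  rw [← gaugeActT_eq_gaugeAct, axialT_gaugeActT, comb_emb hj U g g' hrec, hrec x]
  group

/-- **A bond inside one block reads, in the new gauge, as the comb loop through it conjugated by the coarse gauge**:
`(g • U)⟨x, μ⟩ = g′ y · 𝒰(Γ_{emb y,x} ∪ [x,x+e_μ] ∪ −Γ_{emb y,x+e_μ}) · g′ y⁻¹`. [cite: Balaban1985Averaging, pp.24-25] -/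
theorem gaugeAct_interior_eq (hj : j + 1 ≤ P.m + P.K) (U : GaugeField P j G) (g : Site P j → G) (g' : Site P (j + 1) → G)
    (hrec : ∀ x, g x = g' (blockOf x) * axialT U (emb (blockOf x)) x) (x : Site P j) (μ : Fin P.d)
    (hint : blockOf (x.shift μ) = blockOf x) :
    GaugeField.gaugeAct g U ⟨x, μ⟩ = g' (blockOf x) * holT U (emb (blockOf x)) (contourT (emb (blockOf x)) ⟨x, μ⟩) * (g' (blockOf x))⁻¹ := by
  have h1 : GaugeField.gaugeAct g U ⟨x, μ⟩ = g x * U ⟨x, μ⟩ * (g (x.shift μ))⁻¹ := rfl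
  have h2 : holT U (emb (blockOf x)) (contourT (emb (blockOf x)) ⟨x, μ⟩) =
      axialT U (emb (blockOf x)) x * U ⟨x, μ⟩ * (axialT U (emb (blockOf x)) (x.shift μ))⁻¹ := by
    rw [B10Eq27TorusAxialLog.holT_contourT U (emb (blockOf x)) ⟨x, μ⟩ (noWrap_emb hj rfl μ)]; rfl
  rw [h1, h2, hrec x, hrec (x.shift μ), hint]
  group

/-- ★ **INTERIOR LETTER**: under `PlaqSmall δ U` (`δ ≥ 0`) every bond with both ends in one block is within `|x − emb y|₁·δ ≤ (d(L−1)∕2)·δ` of `1` in the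
new gauge (comb-fan Stokes). [cite: Balaban1985RegularSpaces, Lemma 1 (1.25) p.79; Balaban1985Averaging, pp.24-25] -/
theorem dist1_gaugeAct_interior_le (hj : j + 1 ≤ P.m + P.K) (U : GaugeField P j G) {δ : ℝ} (hδ : 0 ≤ δ) (hU : PlaqSmall δ U)
    (g : Site P j → G) (g' : Site P (j + 1) → G) (hrec : ∀ x, g x = g' (blockOf x) * axialT U (emb (blockOf x)) x)
    (x : Site P j) (μ : Fin P.d) (hint : blockOf (x.shift μ) = blockOf x) :
    dist1 (GaugeField.gaugeAct g U ⟨x, μ⟩) ≤ (P.d * ((P.L - 1) / 2) : ℕ) * δ := by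
  rw [gaugeAct_interior_eq hj U g g' hrec x μ hint, GaugeGroup.dist1_conj, holT_eq_holAt, contourT_eq, revWord_eq_wordRev]
  refine (dist1_holAt_combLoop_le U hδ hU _ (rel (emb (blockOf x)) x) μ).trans ?_
  exact mul_le_mul_of_nonneg_right (by exact_mod_cast l1_rel_emb_le hj rfl) hδ

/-- **A bond leaving the block of `y` through the `μ`-face reads, in the new gauge, as the face word's holonomy between the two coarse gauges**:
`(g • U)⟨x, μ⟩ = g′ y · 𝒰(Γ_{emb y,x} ∪ [x,x+e_μ] ∪ −Γ_{emb y′,x+e_μ}) · g′ y′⁻¹`, `y′ = y + e_μ`. [cite: Balaban1985RegularSpaces, (1.26) p.79] -/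
theorem gaugeAct_face_eq (hj : j + 1 ≤ P.m + P.K) (U : GaugeField P j G) (g : Site P j → G) (g' : Site P (j + 1) → G)
    (hrec : ∀ x, g x = g' (blockOf x) * axialT U (emb (blockOf x)) x) (x : Site P j) (μ : Fin P.d)
    (hface : (x μ).val % P.L + 1 = P.L) :
    GaugeField.gaugeAct g U ⟨x, μ⟩ = g' (blockOf x) *
      holAt U (walk (emb (blockOf x)) (treeWord (rel (emb (blockOf x)) x) ++ [(μ, true)] ++
        wordRev (treeWord (rel (emb ((blockOf x).shift μ)) (x.shift μ))))) * (g' ((blockOf x).shift μ))⁻¹ := by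
  have hx' : blockOf (x.shift μ) = (blockOf x).shift μ := by rw [B10StarCount.blockOf_shift hj, if_pos hface]
  have h1 : GaugeField.gaugeAct g U ⟨x, μ⟩ = g x * U ⟨x, μ⟩ * (g (x.shift μ))⁻¹ := rfl
  rw [holAt_faceWord_of_axial U U (emb (blockOf x)) (emb ((blockOf x).shift μ)) x μ rfl rfl, h1, hrec x, hrec (x.shift μ), hx']
  group

/-- The face word followed by the straight run back is the face loop: its holonomy is `𝒰(Γ₂)·U(c)⁻¹`, `U(c) = axialAvg U ⟨y, μ⟩`.
[cite: Balaban1987RG1, (0.4) p.253] -/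
theorem holAt_faceLoop_eq (U : GaugeField P j G) (y : Site P (j + 1)) (x : Site P j) (μ : Fin P.d) :
    holAt U (walk (emb y) (treeWord (rel (emb y) x) ++ [(μ, true)] ++ wordRev (treeWord (rel (emb (y.shift μ)) (x.shift μ))) ++
        List.replicate P.L (μ, false))) =
      holAt U (walk (emb y) (treeWord (rel (emb y) x) ++ [(μ, true)] ++ wordRev (treeWord (rel (emb (y.shift μ)) (x.shift μ))))) *
        (AveragingRT.axialAvg U ⟨y, μ⟩)⁻¹ := by
  have hend : walkEnd (emb y) (treeWord (rel (emb y) x) ++ [(μ, true)] ++ wordRev (treeWord (rel (emb (y.shift μ)) (x.shift μ)))) =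
      emb (y.shift μ) := by
    rw [walkEnd_append, walkEnd_append, walkEnd_treeWord_rel]
    have h2 : walkEnd x [(μ, true)] = x.shift μ := rfl
    have h3 : walkEnd (x.shift μ) (wordRev (treeWord (rel (emb (y.shift μ)) (x.shift μ)))) = emb (y.shift μ) := by
      have h := walkEnd_walkEnd_wordRev (emb (y.shift μ)) (treeWord (rel (emb (y.shift μ)) (x.shift μ)))
      rwa [walkEnd_treeWord_rel] at h
    rw [h2, h3]
  rw [walk_append, holAt_append, hend, ← holAt_walk_replicate_false_tgt U ⟨y, μ⟩]
  rfl

/-- ★★ **FACE LETTER**: under `PlaqSmall δ U` (`δ ≥ 0`), a bond `⟨x, μ⟩` leaving the block of `y = blockOf x` through its `μ`-face satisfies, in the new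
gauge, `dist1 ≤ dist1((g′ • Ū)⟨y, μ⟩) + dist1(corr ℰ U ⟨y, μ⟩) + ((d(L−1) + L + 1)²∕4)·δ` — the coarse bond of the (0.4) average `Ū = avgFun ℰ U` in the
COARSE gauge, the correction factor of (0.4), and the crude non-abelian Stokes bound of the closed face loop.
[cite: Balaban1985RegularSpaces, Lemma 1 (1.25)-(1.26) pp.79-80; Balaban1987RG1, (0.4) p.253] -/
theorem dist1_gaugeAct_face_le (hj : j + 1 ≤ P.m + P.K) (ℰ : LoopAverage G) (U : GaugeField P j G) {δ : ℝ} (hδ : 0 ≤ δ)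
    (hU : PlaqSmall δ U) (g : Site P j → G) (g' : Site P (j + 1) → G)
    (hrec : ∀ x, g x = g' (blockOf x) * axialT U (emb (blockOf x)) x) (x : Site P j) (μ : Fin P.d)
    (hface : (x μ).val % P.L + 1 = P.L) :
    dist1 (GaugeField.gaugeAct g U ⟨x, μ⟩) ≤
      dist1 (GaugeField.gaugeAct g' (avgFun ℰ U) ⟨blockOf x, μ⟩) + dist1 (corr ℰ U ⟨blockOf x, μ⟩) +
        (((P.d * (P.L - 1) + P.L + 1 : ℕ) : ℝ) ^ 2 / 4) * δ := by
  set y := blockOf x with hy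
  set Θ := holAt U (walk (emb y) (treeWord (rel (emb y) x) ++ [(μ, true)] ++ wordRev (treeWord (rel (emb (y.shift μ)) (x.shift μ)))))
    with hΘ
  set T := AveragingRT.axialAvg U ⟨y, μ⟩ with hT
  set κ := corr ℰ U ⟨y, μ⟩ with hκ
  -- the three factors
  have hW : GaugeField.gaugeAct g U ⟨x, μ⟩ = g' y * Θ * (g' (y.shift μ))⁻¹ := gaugeAct_face_eq hj U g g' hrec x μ hface
  have hB : GaugeField.gaugeAct g' (avgFun ℰ U) ⟨y, μ⟩ = g' y * (κ * T) * (g' (y.shift μ))⁻¹ := rfl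
  have hsplit : GaugeField.gaugeAct g U ⟨x, μ⟩ =
      GaugeField.gaugeAct g' (avgFun ℰ U) ⟨y, μ⟩ * (g' (y.shift μ) * ((κ * T)⁻¹ * Θ) * (g' (y.shift μ))⁻¹) := by
    rw [hW, hB]; group
  -- the loop factor `(κT)⁻¹ Θ` is conjugate to `κ⁻¹ (Θ T⁻¹)`
  have hloop : dist1 ((κ * T)⁻¹ * Θ) ≤ dist1 κ + dist1 (Θ * T⁻¹) := by
    have e1 : (κ * T)⁻¹ * Θ = T⁻¹ * (κ⁻¹ * (Θ * T⁻¹)) * T⁻¹⁻¹ := by group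
    rw [e1, GaugeGroup.dist1_conj]
    calc dist1 (κ⁻¹ * (Θ * T⁻¹)) ≤ dist1 κ⁻¹ + dist1 (Θ * T⁻¹) := GaugeGroup.dist1_mul_le _ _
      _ = dist1 κ + dist1 (Θ * T⁻¹) := by rw [GaugeGroup.dist1_inv]
  -- the closed face loop by crude Stokes
  have hStokes : dist1 (Θ * T⁻¹) ≤ (((P.d * (P.L - 1) + P.L + 1 : ℕ) : ℝ) ^ 2 / 4) * δ := by
    rw [hΘ, hT, ← holAt_faceLoop_eq U y x μ]
    refine (dist1_holAt_le U hδ hU _ (netDisp_faceLoop hj hy.symm hface) (emb y)).trans ?_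
    refine mul_le_mul_of_nonneg_right ?_ hδ
    have hlen : (((treeWord (rel (emb y) x) ++ [(μ, true)] ++ wordRev (treeWord (rel (emb (y.shift μ)) (x.shift μ))) ++
        List.replicate P.L (μ, false)).length : ℕ) : ℝ) ≤ ((P.d * (P.L - 1) + P.L + 1 : ℕ) : ℝ) := by
      exact_mod_cast length_faceLoop_le hj hy.symm hface
    have h0 : (0 : ℝ) ≤ (((treeWord (rel (emb y) x) ++ [(μ, true)] ++ wordRev (treeWord (rel (emb (y.shift μ)) (x.shift μ))) ++
        List.replicate P.L (μ, false)).length : ℕ) : ℝ) := Nat.cast_nonneg _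
    have := pow_le_pow_left₀ h0 hlen 2
    linarith
  calc dist1 (GaugeField.gaugeAct g U ⟨x, μ⟩)
      = dist1 (GaugeField.gaugeAct g' (avgFun ℰ U) ⟨y, μ⟩ * (g' (y.shift μ) * ((κ * T)⁻¹ * Θ) * (g' (y.shift μ))⁻¹)) := by rw [hsplit]
    _ ≤ dist1 (GaugeField.gaugeAct g' (avgFun ℰ U) ⟨y, μ⟩) + dist1 (g' (y.shift μ) * ((κ * T)⁻¹ * Θ) * (g' (y.shift μ))⁻¹) :=
        GaugeGroup.dist1_mul_le _ _
    _ = dist1 (GaugeField.gaugeAct g' (avgFun ℰ U) ⟨y, μ⟩) + dist1 ((κ * T)⁻¹ * Θ) := by rw [GaugeGroup.dist1_conj]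
    _ ≤ _ := by linarith

/-- **THE BOND DICHOTOMY AND THE ONE-LEVEL SUP LETTER**: every bond of height `j` is interior to a block or leaves it through a face (lit
✓`B10StarCount.blockOf_shift`), so under `PlaqSmall δ U`, a uniform bound `s′` on the coarse bonds `(g′ • Ū)` and a uniform bound `κ₀` on the
correction factors, EVERY bond of `g • U` is within `s′ + κ₀ + ((d(L−1) + L + 1)²∕4)·δ` of `1` (the interior letter is dominated by the Stokes constant).
[cite: Balaban1985RegularSpaces, Lemma 1 (1.25) p.79] -/
theorem dist1_gaugeAct_le_of_coarse (hj : j + 1 ≤ P.m + P.K) (ℰ : LoopAverage G) (U : GaugeField P j G) {δ : ℝ} (hδ : 0 ≤ δ)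
    (hU : PlaqSmall δ U) (g : Site P j → G) (g' : Site P (j + 1) → G)
    (hrec : ∀ x, g x = g' (blockOf x) * axialT U (emb (blockOf x)) x)
    {s' κ₀ : ℝ} (hs'0 : 0 ≤ s') (hκ0 : 0 ≤ κ₀) (hs' : ∀ c : PBond P (j + 1), dist1 (GaugeField.gaugeAct g' (avgFun ℰ U) c) ≤ s')
    (hκ : ∀ c : PBond P (j + 1), dist1 (corr ℰ U c) ≤ κ₀) (b : PBond P j) :
    dist1 (GaugeField.gaugeAct g U b) ≤ s' + κ₀ + (((P.d * (P.L - 1) + P.L + 1 : ℕ) : ℝ) ^ 2 / 4) * δ := by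
  obtain ⟨x, μ⟩ := b
  by_cases hface : (x μ).val % P.L + 1 = P.L
  · have h := dist1_gaugeAct_face_le hj ℰ U hδ hU g g' hrec x μ hface
    have h1 := hs' ⟨blockOf x, μ⟩
    have h2 := hκ ⟨blockOf x, μ⟩
    linarith
  · have hint : blockOf (x.shift μ) = blockOf x := by rw [B10StarCount.blockOf_shift hj, if_neg hface]
    have h := dist1_gaugeAct_interior_le hj U hδ hU g g' hrec x μ hint
    -- `d(L−1)/2 ≤ (d(L−1) + L + 1)²/4`
    have hc : ((P.d * ((P.L - 1) / 2) : ℕ) : ℝ) ≤ (((P.d * (P.L - 1) + P.L + 1 : ℕ) : ℝ) ^ 2 / 4) := by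
      have h1 : ((P.d * ((P.L - 1) / 2) : ℕ) : ℝ) ≤ ((P.d * (P.L - 1) + P.L + 1 : ℕ) : ℝ) := by
        have : P.d * ((P.L - 1) / 2) ≤ P.d * (P.L - 1) + P.L + 1 := by
          have := Nat.mul_le_mul_left P.d (Nat.div_le_self (P.L - 1) 2); omega
        exact_mod_cast this
      have h4 : (4 : ℝ) ≤ ((P.d * (P.L - 1) + P.L + 1 : ℕ) : ℝ) := by
        have : 4 ≤ P.d * (P.L - 1) + P.L + 1 := by
          have h1 := P.hL.2; have h2 := P.hd
          have : 1 * 1 ≤ P.d * (P.L - 1) := Nat.mul_le_mul h2 (by omega)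
          omega
        exact_mod_cast this
      have h0 : (0 : ℝ) ≤ ((P.d * ((P.L - 1) / 2) : ℕ) : ℝ) := Nat.cast_nonneg _
      nlinarith
    have := mul_le_mul_of_nonneg_right hc hδ
    linarith

end CombStep

end Summit.QuantumFields.YangMills.Theorems.FluctuationComparisonRegPrIntLS2BetaIterAxialGaugeOneLevel
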